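import Summits.Langlands.Langlands.Theses.TriangulineChamber

/-!
# Birth skeleton (BC3) for piece `SatakeUpgradeRegularGL2` of the decomposition of `LiftB2CrysRamifiedP`
(stmt-Langlands-8574, crux-strategist).  The piece is restated verbatim as a local `def` (it is not
yet a route declaration); `stub_*` are the registered stubs (sorried); `SatakeUpgradeRegularGL2_of` is proved.
-/

set_option linter.dupNamespace false

namespace Summit.Langlands.Langlands.Cruxes.LiftB2CrysRamifiedP.BirthSatakeUpgradeRegularGL2

open Summit.Langlands Summit.Langlands.Langlands.Theses.TriangulineChamber
open scoped Matrix Classical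
open Filter Set Function

/-- piece SatakeUpgradeRegularGL2 (verbatim; child of LiftB2CrysRamifiedP in the strategist split). -/
def SatakeUpgradeRegularGL2 : Prop :=
  ∀ (F : Type) [Field F] [NumberField F] (RD : ReciprocityData F) (hcpt : Literature.NumberTheory.Automorphic.isCompact_glFiniteIntegralLevel 2 F), (∀ π : Literature.NumberTheory.Automorphic.CuspidalAutomorphicRepData 2 F hcpt, π.1.IsLAlgebraic → (∃ T : Literature.NumberTheory.Automorphic.InfinityType F 2, π.1.HasInfinityType T ∧ T.IsRegular) → ∀ (ℓ : ℕ) [Fact ℓ.Prime] (ι : PadicAlgCl ℓ ≃+* ℂ), ∃ ρ : Literature.NumberTheory.GaloisRepresentations.FramedGaloisRep F (PadicAlgCl ℓ) 2, ρ.toGaloisRep.IsIrreducible ∧ IsGeometricFramed RD ρ ∧ Corresponds RD ι π.1 ρ) → ∀ (ℓ : ℕ) [Fact ℓ.Prime] (ι : PadicAlgCl ℓ ≃+* ℂ) (ρ : Literature.NumberTheory.GaloisRepresentations.FramedGaloisRep F (PadicAlgCl ℓ) 2) (π : Literature.NumberTheory.Automorphic.CuspidalAutomorphicRepData 2 F hcpt),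 ρ.toGaloisRep.IsIrreducible → π.1.IsLAlgebraic → (∃ T : Literature.NumberTheory.Automorphic.InfinityType F 2, π.1.HasInfinityType T ∧ T.IsRegular) → (∀ᶠ v : IsDedekindDomain.HeightOneSpectrum (NumberField.RingOfIntegers F) in Filter.cofinite, SatakeFrobCompatibleAt ι π.1 ρ v) → Corresponds RD ι π.1 ρ

/-- **Chebotarev + Brauer–Nesbitt** (stub): two IRREDUCIBLE `ρ, ρ' : Γ_F → GL₂(ℚ̄_ℓ)` attached at
almost all places (Satake–Frobenius) to the same automorphic `π` are conjugate: their Frobenius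
characteristic polynomials agree at almost all places (Satake parameters are unique,
`hasSatakeParamAt_unique_holds`; the dictionary `arithFrobPolyOfSatake` is injective), hence
everywhere by Chebotarev density and continuity, hence `ρ ≅ ρ'` by Brauer–Nesbitt in
characteristic `0` (irreducible ⇒ semisimple), i.e. `ρ = P ρ' P⁻¹`
(`FramedRep.exists_eq_conj_of_equiv`).  Serre 1968, Ch. I §2.3. -/
theorem stub_isConjugate_of_satakeAE : ∀ (F : Type) [Field F] [NumberField F]
    (hcpt : Literature.NumberTheory.Automorphic.isCompact_glFiniteIntegralLevel 2 F) (ℓ : ℕ) [Fact ℓ.Prime] (ι : PadicAlgCl ℓ ≃+* ℂ)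
    (π : Literature.NumberTheory.Automorphic.CuspidalAutomorphicRepData 2 F hcpt) (ρ ρ' : Literature.NumberTheory.GaloisRepresentations.FramedGaloisRep F (PadicAlgCl ℓ) 2),
    ρ.toGaloisRep.IsIrreducible → ρ'.toGaloisRep.IsIrreducible →
    (∀ᶠ v : IsDedekindDomain.HeightOneSpectrum (NumberField.RingOfIntegers F) in Filter.cofinite, SatakeFrobCompatibleAt ι π.1 ρ v) →
    (∀ᶠ v : IsDedekindDomain.HeightOneSpectrum (NumberField.RingOfIntegers F) in Filter.cofinite, SatakeFrobCompatibleAt ι π.1 ρ' v) →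
    IsConjugate ρ' ρ := by
  sorry

/-- **`Corresponds` is an isomorphism invariant** (stub): if `ρ = P ρ' P⁻¹` then
`Corresponds RD ι π ρ' → Corresponds RD ι π ρ` — unramifiedness and Frobenius characteristic
polynomials are conjugation invariant (`hasFrobCharpolyAt_conj_iff`), the `ℓ`-adic Weil–Deligne
representation and its transport along `ι` are conjugated along, Fontaine's datum does not see the
frame (`PstWeilDeligneData.conj`), and `HasFrobSemisimpleClass` is a statement about a class.
Serre 1968, Ch. I §1.1. -/
theorem stub_corresponds_of_isConjugate : ∀ (F : Type) [Field F] [NumberField F]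
    (RD : ReciprocityData F) (hcpt : Literature.NumberTheory.Automorphic.isCompact_glFiniteIntegralLevel 2 F) (ℓ : ℕ) [Fact ℓ.Prime] (ι : PadicAlgCl ℓ ≃+* ℂ)
    (π : Literature.NumberTheory.Automorphic.CuspidalAutomorphicRepData 2 F hcpt) (ρ ρ' : Literature.NumberTheory.GaloisRepresentations.FramedGaloisRep F (PadicAlgCl ℓ) 2),
    IsConjugate ρ' ρ → Corresponds RD ι π.1 ρ' → Corresponds RD ι π.1 ρ := by
  sorry

/-- The piece from the two stubs: direction (A) for the regular `π` gives an irreducible `ρ'` with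
`Corresponds RD ι π ρ'`, in particular attached at almost all places; `ρ` and `ρ'` are conjugate
(`stub_isConjugate_of_satakeAE`) and `Corresponds` transports (`stub_corresponds_of_isConjugate`). -/
theorem SatakeUpgradeRegularGL2_of
    (h1 : ∀ (F : Type) [Field F] [NumberField F]
      (hcpt : Literature.NumberTheory.Automorphic.isCompact_glFiniteIntegralLevel 2 F) (ℓ : ℕ) [Fact ℓ.Prime] (ι : PadicAlgCl ℓ ≃+* ℂ)
      (π : Literature.NumberTheory.Automorphic.CuspidalAutomorphicRepData 2 F hcpt) (ρ ρ' : Literature.NumberTheory.GaloisRepresentations.FramedGaloisRep F (PadicAlgCl ℓ) 2),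
      ρ.toGaloisRep.IsIrreducible → ρ'.toGaloisRep.IsIrreducible →
      (∀ᶠ v : IsDedekindDomain.HeightOneSpectrum (NumberField.RingOfIntegers F) in Filter.cofinite, SatakeFrobCompatibleAt ι π.1 ρ v) →
      (∀ᶠ v : IsDedekindDomain.HeightOneSpectrum (NumberField.RingOfIntegers F) in Filter.cofinite, SatakeFrobCompatibleAt ι π.1 ρ' v) →
      IsConjugate ρ' ρ)
    (h2 : ∀ (F : Type) [Field F] [NumberField F]
      (RD : ReciprocityData F) (hcpt : Literature.NumberTheory.Automorphic.isCompact_glFiniteIntegralLevel 2 F) (ℓ : ℕ) [Fact ℓ.Prime] (ι : PadicAlgCl ℓ ≃+* ℂ)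
      (π : Literature.NumberTheory.Automorphic.CuspidalAutomorphicRepData 2 F hcpt) (ρ ρ' : Literature.NumberTheory.GaloisRepresentations.FramedGaloisRep F (PadicAlgCl ℓ) 2),
      IsConjugate ρ' ρ → Corresponds RD ι π.1 ρ' → Corresponds RD ι π.1 ρ) :
    SatakeUpgradeRegularGL2 := by
  intro F _ _ RD hcpt hA ℓ _ ι ρ π hirr hL hreg hsat
  obtain ⟨ρ', hirr', _hgeom', hcorr'⟩ := hA π hL hreg ℓ ι
  exact h2 F RD hcpt ℓ ι π ρ ρ' (h1 F hcpt ℓ ι π ρ ρ' hirr hirr' hsat hcorr'.1) hcorr'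

end Summit.Langlands.Langlands.Cruxes.LiftB2CrysRamifiedP.BirthSatakeUpgradeRegularGL2
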